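import Summits.Ventures.HSemireg.WedgeHankelBoxSiegelIdealCommon

/-!
# Venture HSemireg — THE BOX SIEGEL IDEAL, test families: the `Π_i (m_i + 1)` BOXES OF POWERS `E_{p₀} ⊠ ⋯ ⊠ E_{p_{n−1}}` (`Θ_i^{p_i}/p_i!`, `p_i ≤ m_i`)
# DETECT the box Siegel ideal in every degree — multilinearity of the Hankel box in the factor classes

HONEST FRAMING. Part of the Lean index of the computation cell `pub-hsemireg` (seat p10 gen 12, Sunday typer «UNIFORM-IN-n»).
Finite-dimensional EXTERIOR ALGEBRA over a field ONLY: no variety, no cohomology theory, no sheaf, no Ext group, no semiregularity map; nothing here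
says that HC / HC_CM / HC_AV holds; no Literature fact is declared or used.  Custodian versions as in `WedgeHankelBoxSiegelIdeal` (1/3); the dictionary
(`Θ_i^p/p! ↦ δ_p ↦ E_p = w_{m_i}(δ_p)` on factor `i`; `⌟(v₀ ⊠ ⋯ ⊠ v_{n−1})` ↦ `θ ↦ θ ∧ (v₀ ∧ ⋯ ∧ v_{n−1})`) is QUOTED, never asserted.

THIS FILE (namespace `Summit.Ventures.HSemireg.Wedge.HankelBoxSiegelIdeal` continued; imports (3/3) `WedgeHankelBoxSiegelIdealCommon`):
* §12 the ordered product `prodR` is LINEAR IN EACH SLOT past that slot (`prodR_update_of_le`, `prodR_sum_slot`); updating the class `q_j` updates the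
  factor `v_j` only (`hfac_update`); with gen 11's linearity `w_m(q) = Σ_{p ≤ m} q_p · E_p` (`w_eq_sum_spikes`): **`hankelBox_eq_sum_update`: the Hankel box
  is linear in the class of each factor — `F(q) = Σ_{p ≤ m_j} (q_j)_p · F(q[j ↦ δ_p])`**.
* §13 **`mul_hankelBox_eq_zero_of_forall_spikes`: a form killed by the `Π_i (m_i+1)` boxes of powers `E_{p₀} ∧ ⋯ ∧ E_{p_{n−1}}` (`p_i ≤ m_i`) is killed by
  EVERY Hankel box** (induction on the number of non-spike factors), hence with (3/3) **`mem_boxSiegelIdeal_iff_forall_spikes`: for `θ ∈ ⋀^k`,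
  `θ ∈ boxSiegelIdeal_k ⟺ θ ∧ (E_{p₀} ∧ ⋯ ∧ E_{p_{n−1}}) = 0` for every tuple `p_i ≤ m_i`** — a FINITE test family for the box Siegel ideal in every degree
  (one factor: gen 11 #4's `{E_0, …, E_m}`).
NOT typed (honest): smaller test families (one factor, degree `k ≤ m`: `{E_0, …, E_k}` by gen 11 #10; the box analogue is not attempted); anything Ext-side.
Class side only.
-/

open Module

namespace Summit.Ventures.HSemireg.Wedge.HankelBoxSiegelIdeal

open Summit.Ventures.HSemireg.Wedge Summit.Ventures.HSemireg.Wedge.Kunneth Summit.Ventures.HSemireg.Wedge.MixedBox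
  Summit.Ventures.HSemireg.Wedge.HankelSiegel Summit.Ventures.HSemireg.Wedge.HankelSiegelIdeal
  Summit.Ventures.HSemireg.Wedge.HankelBox

variable (K : Type*) [Field K]

/-! ## §12. The Hankel box is linear in the class of each factor -/

section Slot

variable {I : Type*} [LinearOrder I] [Fintype I]

omit [LinearOrder I] [Fintype I] in
/-- updating a slot at or beyond `N` does not change `f 0 ∧ ⋯ ∧ f (N−1)`. -/
lemma prodR_update_of_le (f : ℕ → HT K I) {j : ℕ} (y : HT K I) : ∀ {N : ℕ}, N ≤ j → prodR K (Function.update f j y) N = prodR K f N := by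
  intro N
  induction N with
  | zero => intro; rfl
  | succ N ih =>
    intro hN
    rw [prodR_succ, prodR_succ, ih (by omega), Function.update_of_ne (by omega : N ≠ j)]

omit [LinearOrder I] [Fintype I] in
/-- **the ordered product is linear in slot `j` once the product passes slot `j`**: if `f j = Σ_{p ∈ P} c_p · x_p` then
`f 0 ∧ ⋯ ∧ f (N−1) = Σ_p c_p · (f with slot j replaced by x_p) 0 ∧ ⋯` for `N > j`. -/
theorem prodR_sum_slot (f : ℕ → HT K I) {j : ℕ} {P : Finset ℕ} (c : ℕ → K) (x : ℕ → HT K I) (hf : f j = ∑ p ∈ P, c p • x p) :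
    ∀ {N : ℕ}, j < N → prodR K f N = ∑ p ∈ P, c p • prodR K (Function.update f j (x p)) N := by
  intro N
  induction N with
  | zero => intro h; omega
  | succ N ih =>
    intro hN
    rcases Nat.lt_succ_iff_lt_or_eq.mp hN with hlt | heq
    · rw [prodR_succ, ih hlt, Finset.sum_mul]
      refine Finset.sum_congr rfl fun p _ => ?_
      rw [prodR_succ, Function.update_of_ne (by omega : N ≠ j), smul_mul_assoc]
    · subst heq
      rw [prodR_succ, hf, Finset.mul_sum]
      refine Finset.sum_congr rfl fun p _ => ?_
      rw [prodR_succ, prodR_update_of_le K f (x p) le_rfl, Function.update_self, mul_smul_comm]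

end Slot

section Box

variable {n : ℕ} (m : Fin n → ℕ)

/-- updating the class of factor `j` updates the factor `v_j` only: `hfac (q[j ↦ ρ]) = (hfac q)[j ↦ emb_j(w_{m_j}(ρ))]`. -/
lemma hfac_update (q : Fin n → ℕ → K) {j : ℕ} (hj : j < n) (ρ : ℕ → K) :
    hfac K m (Function.update q ⟨j, hj⟩ ρ) =
      Function.update (hfac K m q) j (emb K (facEmb m ⟨j, hj⟩) (Hankel.w K (m ⟨j, hj⟩) (m ⟨j, hj⟩) ρ)) := by
  funext i
  by_cases hij : i = j
  · subst hij
    rw [Function.update_self, hfac_update_self K m q hj ρ]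
  · rw [Function.update_of_ne hij]
    by_cases hi : i < n
    · rw [hfac, hfac, dif_pos hi, dif_pos hi, Function.update_of_ne (fun h => hij (by simpa using congrArg Fin.val h))]
    · rw [hfac, hfac, dif_neg hi, dif_neg hi]

/-- the factor `v_j` expanded in powers: `v_j(q) = Σ_{p ≤ m_j} (q_j)_p · emb_j(E_p)` (gen 11's `w_eq_sum_spikes`, embedded). -/
lemma hfac_eq_sum_spikes (q : Fin n → ℕ → K) {j : ℕ} (hj : j < n) :
    hfac K m q j = ∑ p ∈ Finset.range (m ⟨j, hj⟩ + 1),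
      q ⟨j, hj⟩ p • emb K (facEmb m ⟨j, hj⟩) (Hankel.w K (m ⟨j, hj⟩) (m ⟨j, hj⟩) (fun t => if t = p then (1 : K) else 0)) := by
  rw [hfac, dif_pos hj, w_eq_sum_spikes, map_sum]
  refine Finset.sum_congr rfl fun p _ => ?_
  rw [map_smul]

/-- **THE HANKEL BOX IS LINEAR IN THE CLASS OF EACH FACTOR: `F(q) = Σ_{p ≤ m_j} (q_j)_p · F(q[j ↦ δ_p])`** (`j < n`). -/
theorem hankelBox_eq_sum_update (q : Fin n → ℕ → K) {j : ℕ} (hj : j < n) :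
    hankelBox K m q = ∑ p ∈ Finset.range (m ⟨j, hj⟩ + 1), q ⟨j, hj⟩ p • hankelBox K m (Function.update q ⟨j, hj⟩ (fun t => if t = p then (1 : K) else 0)) := by
  rw [hankelBox, prodR_sum_slot K (hfac K m q) (fun p => q ⟨j, hj⟩ p)
    (fun p => emb K (facEmb m ⟨j, hj⟩) (Hankel.w K (m ⟨j, hj⟩) (m ⟨j, hj⟩) (fun t => if t = p then (1 : K) else 0))) (hfac_eq_sum_spikes K m q hj) hj]
  refine Finset.sum_congr rfl fun p _ => ?_
  rw [hankelBox, hfac_update K m q hj]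

/-! ## §13. The boxes of powers detect the box Siegel ideal -/

/-- induction on the number of free (non-spike) factors: if the boxes of powers kill `θ`, so does every box whose factors `≥ j` are powers. -/
lemma mul_hankelBox_eq_zero_of_spikes_from {θ : HT K (Gen m)}
    (h : ∀ p : Fin n → ℕ, (∀ i, p i ≤ m i) → θ * hankelBox K m (fun i => (fun t => if t = p i then (1 : K) else 0)) = 0) :
    ∀ (j : ℕ) (q : Fin n → ℕ → K), (∀ i : Fin n, j ≤ (i : ℕ) → ∃ p ≤ m i, q i = (fun t => if t = p then (1 : K) else 0)) → θ * hankelBox K m q = 0 := by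
  intro j
  induction j with
  | zero =>
    intro q hq
    choose p hp hq' using fun i : Fin n => hq i (Nat.zero_le _)
    have : q = fun i => (fun t => if t = p i then (1 : K) else 0) := funext hq'
    rw [this]
    exact h p hp
  | succ j ih =>
    intro q hq
    by_cases hj : j < n
    · rw [hankelBox_eq_sum_update K m q hj, Finset.mul_sum]
      refine Finset.sum_eq_zero fun p hp => ?_
      rw [mul_smul_comm, ih _ fun i hi => ?_, smul_zero]
      by_cases hij : (i : ℕ) = j
      · have : i = ⟨j, hj⟩ := Fin.ext hij
        subst this
        exact ⟨p, by simpa [Finset.mem_range, Nat.lt_succ_iff] using hp, Function.update_self _ _ _⟩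
      · obtain ⟨p', hp', hq'⟩ := hq i (by omega)
        exact ⟨p', hp', by rw [Function.update_of_ne (fun h => hij (by simpa using congrArg Fin.val h)), hq']⟩
    · exact ih q fun i _ => hq i (by have := i.2; omega)

/-- **A FORM KILLED BY THE `Π_i (m_i + 1)` BOXES OF POWERS `E_{p₀} ∧ ⋯ ∧ E_{p_{n−1}}` (`p_i ≤ m_i`) IS KILLED BY EVERY HANKEL BOX.** -/
theorem mul_hankelBox_eq_zero_of_forall_spikes {θ : HT K (Gen m)}
    (h : ∀ p : Fin n → ℕ, (∀ i, p i ≤ m i) → θ * hankelBox K m (fun i => (fun t => if t = p i then (1 : K) else 0)) = 0) (q : Fin n → ℕ → K) :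
    θ * hankelBox K m q = 0 :=
  mul_hankelBox_eq_zero_of_spikes_from K m h n q fun i hi => absurd i.2 (by omega)

/-- **THE BOXES OF POWERS DETECT THE BOX SIEGEL IDEAL: for `θ ∈ ⋀^k`, `θ ∈ boxSiegelIdeal_k ⟺ θ ∧ (E_{p₀} ∧ ⋯ ∧ E_{p_{n−1}}) = 0` for every tuple
`p_i ≤ m_i`** — a finite test family of `Π_i (m_i+1)` boxes, in every degree, for every field, number of factors and dimensions. -/
theorem mem_boxSiegelIdeal_iff_forall_spikes {k : ℕ} {θ : HT K (Gen m)} (hθ : θ ∈ ⋀[K]^k (Gen m → K)) :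
    θ ∈ boxSiegelIdeal K m k ↔ ∀ p : Fin n → ℕ, (∀ i, p i ≤ m i) → θ * hankelBox K m (fun i => (fun t => if t = p i then (1 : K) else 0)) = 0 :=
  ⟨fun h _ _ => mul_hankelBox_eq_zero_of_mem_boxSI K m h _,
    fun h => (mem_boxSiegelIdeal_iff_forall_mul_hankelBox K m hθ).mpr (mul_hankelBox_eq_zero_of_forall_spikes K m h)⟩

/-- the same as an intersection of finitely many kernels: **`⋂_{p ≤ m} ker(θ ↦ θ ∧ (E_{p₀} ∧ ⋯ ∧ E_{p_{n−1}}) ∣ ⋀^k) = boxSiegelIdeal_k`.** -/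
theorem iInf_ker_wedge_spikeBox (k : ℕ) :
    (⨅ p : {p : Fin n → ℕ // ∀ i, p i ≤ m i}, LinearMap.ker (wedge K (Gen m) k (hankelBox K m fun i => (fun t => if t = p.1 i then (1 : K) else 0)))) =
      (boxSiegelIdeal K m k).comap (⋀[K]^k (Gen m → K)).subtype := by
  apply le_antisymm
  · intro θ hθ
    refine (mem_boxSiegelIdeal_iff_forall_spikes K m θ.2).mpr fun p hp => ?_
    have := (Submodule.mem_iInf _).mp hθ ⟨p, hp⟩
    rwa [LinearMap.mem_ker, wedge, LinearMap.comp_apply, Submodule.subtype_apply, LinearMap.mulRight_apply] at this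
  · exact le_iInf fun p => boxSiegelIdeal_le_ker K m k _

end Box

end Summit.Ventures.HSemireg.Wedge.HankelBoxSiegelIdeal
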